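import Mathlib
import HarnessLib
import Summits.Ventures.LatticeQCDFlow.Exactness.MomentumRefresh
import Summits.Ventures.LatticeQCDFlow.Exactness.SplittingIntegrator
import Summits.Ventures.LatticeQCDFlow.Exactness.CompactHaar
import Summits.Ventures.LatticeQCDFlow.Exactness.Phi4LeapfrogPerm
import Summits.Ventures.LatticeQCDFlow.Exactness.StdGaussianRadial
import Summits.Ventures.LatticeQCDFlow.Exactness.CircleGroupJacobian

/-!
# Gauge-link FT-HMC exactly as the engine runs it — momentum heat bath, leapfrog `V ← e(p)·V`, `p ← p + g(V)` through the pulled-back action with ANY measurable force, flip, Metropolis, report through the map — is exact; the U(1) rung with Gaussian momenta has no hypothesis left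

HONEST FRAMING: exact (Metropolis-corrected) sampling algorithms for lattice gauge theory;
figures of merit are autocorrelation/cost numbers at stated couplings and volumes; no
continuum-physics claim.

Venture `LatticeQCDFlow` (cell pub-lqcd), topic `Exactness`; FANOUT row 14 (`eng-flowhmc`, engine
`latflow.fthmc`: `dynamics.Dynamics` = refresh `π`, leapfrog / OMF for
`H̃(V, π) = ½|π|² + S(F V) − log det F_*(V)` with `V ← exp(c π) V`, `π ← π − c ∂S̃`, accept on
`ΔH̃`, report `F V`).  NEW WORK of the cell: an ASSEMBLY, for the gauge-link phase space, of row 7's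
`MomentumRefresh` (`hmc_config_exact`, `thmc_config_exact`: refresh–propose–accept–forget with an
abstract involution), row 9's `SplittingIntegrator` (`flip`, `kick`, `mulDrift`, `leapfrog`,
time reversal and Liouville for the group drift), `CompactHaar` (Haar instances), row 2's
`Phi4LeapfrogPerm.isNegInvariant_volume_pi`, `StdGaussianRadial.lintegral_prod_pi`.  Nothing is
cited as a fact.  Printed counterparts, named only: Duane–Kennedy–Pendleton–Roweth 1987,
Lüscher 2010 §2.3–2.4 (eqs. (2.9)–(2.13)), Kennedy–Pendleton / Gottlieb et al. 1987 (gauge-link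
leapfrog `U ← e^{iεP} U`).

The two existing end-to-end statements leave the integrator abstract (`TransformedHMC`,
`MomentumRefresh`: "ANY measurable `vol ⊗ volP`-preserving involution") or omit the refresh and
the map (`SplittingIntegrator.gaugeLeapfrogHMC_isReversible`).  Row 14's acceptance test is
about the concrete composite; this file types it: the statement below IS the engine's update,
with the force `g` an ARBITRARY measurable function — so exactness does not depend on the
autodiff force being the true gradient of `S̃`, on the step size, or on the trajectory length
(these only move the acceptance rate), which is what the `⟨e^{−ΔH}⟩ = 1` / reversibility columns
test numerically.

## Content

* `involutive_gaugeLeapfrogProposal`, `measurePreserving_gaugeLeapfrogProposal` — on `Q × P`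
  (`Q` a measurable group with left-invariant `μ`, `P` an additive group with reflection- and
  translation-invariant `ν`) the proposal `flip ∘ (drift_e ∘ kick_g ∘ drift_e)^n` with
  `e(−p) = e(p)⁻¹` is an involution preserving `μ ⊗ ν`, for every measurable `e`, `g`, every `n`;
* **`gauge_hmc_leapfrog_config_exact`** — gauge-link HMC as the code runs it (refresh
  `π ∼ Z_T⁻¹e^{−T}ν`, that proposal for `H = S + T`, Metropolis, forget `π`) leaves `e^{−S}·μ`
  invariant (`0 < Z_T < ∞`);
* **`gauge_fthmc_leapfrog_config_exact`** — gauge-link FT-HMC as the code runs it: the same for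
  `H̃ = (S ∘ F − log J) + T` with `F : Q ≃ᵐ Q`, `HasJacobian μ F (ofReal ∘ J)`, `J > 0`
  measurable, REPORTED through `F`, leaves `e^{−S}·μ` invariant;
* `circleDrift_neg`, `measurable_circleDrift` (the engine's U(1) link drift
  `V_i ← e^{i c p_i} V_i`), **`piGaussianWeight_univ_ne_zero_ne_top`** (`e^{−Σ p_i²/2}` has finite
  non-zero mass for Lebesgue measure on `ℝ^ι`);
* **`u1_hmc_leapfrog_gaussian_exact`**, **`u1_fthmc_leapfrog_gaussian_exact`** — THE U(1) RUNG
  WITH NOTHING LEFT ABSTRACT BUT THE MEMBER: links `ι → U(1)` with product Haar probability,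
  momenta `ι → ℝ` with Lebesgue measure and `T = Σ_i p_i²/2`, drift `V_i ← e^{i c p_i} V_i`, any
  measurable force, any `n`; for any member `F` with certified positive Jacobian (the U(1)
  coupling layers and their lists: `U1MaskedLayerEquiv`, `DegreeOneLayerEquiv`, `NCPLayerEquiv`)
  the reported configuration chain leaves `e^{−S}·Haar^ι` invariant.

NOT here: ergodicity / irreducibility; OMF2 / OMF4 words (covered abstractly by
`IsFlipReversible.symmetricWord`, not instantiated); SU(N) members (no certified Jacobian in the
tree); any number.
-/

noncomputable section

namespace Summit.Ventures.LatticeQCDFlow.Exactness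

open Set Function MeasureTheory Filter
open ProbabilityTheory ProbabilityTheory.Kernel
open Literature.MathematicalPhysics.QuantumFieldTheory (haarProbability)
open scoped NNReal ENNReal Topology

/-! ## The gauge leapfrog proposal: involutive and Liouville -/

section Gauge

variable {Q P : Type*}

/-- The gauge leapfrog proposal `flip ∘ (drift_e kick_g drift_e)^n` is an involution as soon as
`e(−p) = e(p)⁻¹` — for every force `g` and trajectory length `n`. -/
theorem involutive_gaugeLeapfrogProposal [Group Q] [AddCommGroup P] {e : P → Q}
    (he : ∀ p, e (-p) = (e p)⁻¹) (g : Q → P) (n : ℕ) :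
    Function.Involutive (⇑((flip : Equiv.Perm (Q × P)) * leapfrog (mulDrift e) g ^ n)) :=
  (leapfrog_pow_isFlipReversible (mulDrift_reversal he) g n).involutive

/-- The gauge leapfrog proposal preserves `μ ⊗ ν` (left-invariant `μ` on the links, reflection-
and translation-invariant `ν` on the momenta) — for every measurable `e`, `g` and every `n`. -/
theorem measurePreserving_gaugeLeapfrogProposal [Group Q] [MeasurableSpace Q] [MeasurableMul₂ Q]
    {μ : Measure Q} [μ.IsMulLeftInvariant] [SFinite μ] [AddCommGroup P] [MeasurableSpace P]
    [MeasurableNeg P] [MeasurableAdd₂ P] {ν : Measure P} [ν.IsNegInvariant]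
    [ν.IsAddRightInvariant] [SFinite ν] {e : P → Q} (hem : Measurable e) {g : Q → P}
    (hg : Measurable g) (n : ℕ) :
    MeasurePreserving (⇑((flip : Equiv.Perm (Q × P)) * leapfrog (mulDrift e) g ^ n))
      (μ.prod ν) (μ.prod ν) := by
  rw [Equiv.Perm.coe_mul]
  exact measurePreserving_flip.comp (measurePreserving_perm_pow
    (measurePreserving_leapfrog (measurable_mulDrift hem) (measurePreserving_mulDrift e) hg) n)

/-- **Gauge-link HMC as the code runs it is exact.**  Links in a measurable group `Q` with
left-invariant s-finite `μ`; momenta in an additive group `P` with reflection- and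
translation-invariant s-finite `ν`; kinetic term `T` with `0 < Z_T = ∫ e^{−T} dν < ∞`; drift
`U ↦ e(p) · U` with `e(−p) = e(p)⁻¹` measurable; ANY measurable force `g`; any trajectory length
`n`.  Refresh `π ∼ Z_T⁻¹ e^{−T}·ν` → propose `flip (leapfrog^n (U, π))` → accept with
`min(1, e^{−ΔH})`, `H = S + T` → forget `π`: this configuration kernel leaves `e^{−S}·μ`
invariant. -/
theorem gauge_hmc_leapfrog_config_exact [Group Q] [MeasurableSpace Q] [MeasurableMul₂ Q]
    {μ : Measure Q} [μ.IsMulLeftInvariant] [SFinite μ] [AddCommGroup P] [MeasurableSpace P]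
    [MeasurableNeg P] [MeasurableAdd₂ P] {ν : Measure P} [ν.IsNegInvariant]
    [ν.IsAddRightInvariant] [SFinite ν] {e : P → Q} (he : ∀ p, e (-p) = (e p)⁻¹)
    (hem : Measurable e) {g : Q → P} (hg : Measurable g) (n : ℕ)
    {S : Q → ℝ} (hS : Measurable S) {T : P → ℝ} (hT : Measurable T)
    (hZ0 : ν.withDensity (fun q => ENNReal.ofReal (Real.exp (-T q))) Set.univ ≠ 0)
    (hZtop : ν.withDensity (fun q => ENNReal.ofReal (Real.exp (-T q))) Set.univ ≠ ∞) :
    Invariant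
      (refreshUpdate
        (involMH (⇑((flip : Equiv.Perm (Q × P)) * leapfrog (mulDrift e) g ^ n))
          (measurable_flip_leapfrog_pow (measurable_mulDrift hem) hg n)
          fun z : Q × P => S z.1 + T z.2)
        ((ν.withDensity (fun q => ENNReal.ofReal (Real.exp (-T q))) Set.univ)⁻¹ •
          ν.withDensity fun q => ENNReal.ofReal (Real.exp (-T q))))
      (μ.withDensity fun u => ENNReal.ofReal (Real.exp (-S u))) :=
  hmc_config_exact hS hT (involutive_gaugeLeapfrogProposal he g n)
    (measurePreserving_gaugeLeapfrogProposal hem hg n) hZ0 hZtop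

/-- **Gauge-link FT-HMC as `latflow.fthmc` runs it is exact.**  As above, plus a field
transformation `F : Q ≃ᵐ Q` with positive measurable Jacobian `J` (`F_*(J·μ) = μ`): refresh
`π ∼ Z_T⁻¹ e^{−T}·ν` → leapfrog^n with the group drift and ANY measurable force (in the code:
the autodiff gradient of the pulled-back action; its accuracy is irrelevant here) → flip →
accept with `min(1, e^{−ΔH̃})`, `H̃(V, π) = (S (F V) − log J V) + T π` → forget `π` → REPORT
`U = F V`.  The reported configuration kernel leaves `e^{−S}·μ` invariant. -/
theorem gauge_fthmc_leapfrog_config_exact [Group Q] [MeasurableSpace Q] [MeasurableMul₂ Q]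
    {μ : Measure Q} [μ.IsMulLeftInvariant] [SFinite μ] [AddCommGroup P] [MeasurableSpace P]
    [MeasurableNeg P] [MeasurableAdd₂ P] {ν : Measure P} [ν.IsNegInvariant]
    [ν.IsAddRightInvariant] [SFinite ν] {F : Q ≃ᵐ Q} {J : Q → ℝ} (hJ : ∀ v, 0 < J v)
    (hJm : Measurable J) (hF : HasJacobian μ F fun v => ENNReal.ofReal (J v))
    {e : P → Q} (he : ∀ p, e (-p) = (e p)⁻¹) (hem : Measurable e) {g : Q → P}
    (hg : Measurable g) (n : ℕ) {S : Q → ℝ} (hS : Measurable S) {T : P → ℝ} (hT : Measurable T)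
    (hZ0 : ν.withDensity (fun q => ENNReal.ofReal (Real.exp (-T q))) Set.univ ≠ 0)
    (hZtop : ν.withDensity (fun q => ENNReal.ofReal (Real.exp (-T q))) Set.univ ≠ ∞) :
    Invariant
      (conjKernel
        (refreshUpdate
          (involMH (⇑((flip : Equiv.Perm (Q × P)) * leapfrog (mulDrift e) g ^ n))
            (measurable_flip_leapfrog_pow (measurable_mulDrift hem) hg n)
            fun z : Q × P => (S (F z.1) - Real.log (J z.1)) + T z.2)
          ((ν.withDensity (fun q => ENNReal.ofReal (Real.exp (-T q))) Set.univ)⁻¹ •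
            ν.withDensity fun q => ENNReal.ofReal (Real.exp (-T q))))
        F)
      (μ.withDensity fun u => ENNReal.ofReal (Real.exp (-S u))) :=
  thmc_config_exact hJ hJm hF hS hT (involutive_gaugeLeapfrogProposal he g n)
    (measurePreserving_gaugeLeapfrogProposal hem hg n) hZ0 hZtop

end Gauge

/-! ## The U(1) rung: product Haar links, Lebesgue momenta, Gaussian kinetic term -/

section U1

variable {ι : Type*} [Fintype ι]

omit [Fintype ι] in
/-- The engine's U(1) link drift `V_i ← e^{i c p_i} V_i`, i.e. `e p = (e^{i c p_i})_i`, obeys the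
time-reversal law `e(−p) = e(p)⁻¹`. -/
theorem circleDrift_neg (c : ℝ) (p : ι → ℝ) :
    (fun i => Circle.exp (c * (-p) i)) = (fun i => Circle.exp (c * p i))⁻¹ := by
  funext i
  simp only [Pi.neg_apply, Pi.inv_apply, mul_neg, Circle.exp_neg]

omit [Fintype ι] in
/-- The U(1) link drift is measurable in the momenta. -/
theorem measurable_circleDrift (c : ℝ) :
    Measurable fun p : ι → ℝ => fun i => Circle.exp (c * p i) := by
  refine measurable_pi_lambda _ fun i => ?_
  have h1 : Measurable fun p : ι → ℝ => p i := measurable_pi_apply i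
  exact Circle.exp.continuous.measurable.comp (h1.const_mul c)

/-- **The Gaussian momentum weight `e^{−Σ_i p_i²/2}` has finite, non-zero mass for Lebesgue
measure on `ℝ^ι`** (Tonelli over the coordinates; each factor is a positive integrable
Gaussian). -/
theorem piGaussianWeight_univ_ne_zero_ne_top :
    (volume : Measure (ι → ℝ)).withDensity
        (fun p => ENNReal.ofReal (Real.exp (-(∑ i, p i ^ 2 / 2)))) Set.univ ≠ 0 ∧
    (volume : Measure (ι → ℝ)).withDensity
        (fun p => ENNReal.ofReal (Real.exp (-(∑ i, p i ^ 2 / 2)))) Set.univ ≠ ⊤ := by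
  have hmeas1 : Measurable fun x : ℝ => ENNReal.ofReal (Real.exp (-(x ^ 2 / 2))) :=
    (Real.measurable_exp.comp ((measurable_id.pow_const 2).div_const 2).neg).ennreal_ofReal
  have h1 : ∀ p : ι → ℝ, ENNReal.ofReal (Real.exp (-(∑ i, p i ^ 2 / 2))) =
      ∏ i, ENNReal.ofReal (Real.exp (-(p i ^ 2 / 2))) := by
    intro p
    rw [← ENNReal.ofReal_prod_of_nonneg (fun i _ => (Real.exp_pos _).le), ← Real.exp_sum,
      ← Finset.sum_neg_distrib]
  rw [withDensity_apply _ MeasurableSet.univ, Measure.restrict_univ, volume_pi]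
  simp_rw [h1]
  rw [lintegral_prod_pi (fun _ : ι => (volume : Measure ℝ)) (fun _ => hmeas1)]
  -- the one-coordinate factor `∫ e^{−x²/2} dx` is non-zero …
  have hZ0 : (∫⁻ x : ℝ, ENNReal.ofReal (Real.exp (-(x ^ 2 / 2)))) ≠ 0 := by
    intro h0
    rw [lintegral_eq_zero_iff hmeas1] at h0
    have h1 : (volume : Measure ℝ) {x | ENNReal.ofReal (Real.exp (-(x ^ 2 / 2))) ≠ 0} = 0 := by
      have := h0
      rw [Filter.EventuallyEq, ae_iff] at this
      simpa using this
    have huniv : {x : ℝ | ENNReal.ofReal (Real.exp (-(x ^ 2 / 2))) ≠ 0} = Set.univ := by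
      refine Set.eq_univ_of_forall fun x => ?_
      rw [Set.mem_setOf_eq, Ne, ENNReal.ofReal_eq_zero, not_le]
      exact Real.exp_pos _
    rw [huniv, Real.volume_univ] at h1
    exact ENNReal.top_ne_zero h1
  -- … and finite
  have hZtop : (∫⁻ x : ℝ, ENNReal.ofReal (Real.exp (-(x ^ 2 / 2)))) ≠ ⊤ := by
    have hint : Integrable (fun x : ℝ => Real.exp (-(x ^ 2 / 2))) := by
      refine (integrable_exp_neg_mul_sq (b := 1 / 2) (by norm_num)).congr
        (Filter.Eventually.of_forall fun x => ?_)
      simp only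
      congr 1
      ring
    exact hint.lintegral_lt_top.ne
  exact ⟨Finset.prod_ne_zero_iff.2 fun i _ => hZ0, ENNReal.prod_ne_top fun i _ => hZtop⟩

/-- The Gaussian kinetic term `T = Σ_i p_i²/2` is measurable. -/
theorem measurable_piGaussianKinetic : Measurable fun p : ι → ℝ => ∑ i, p i ^ 2 / 2 := by
  refine Finset.measurable_sum _ fun i _ => ?_
  have h1 : Measurable fun p : ι → ℝ => p i := measurable_pi_apply i
  exact (h1.pow_const 2).div_const 2

/-- **HMC on the U(1) rung as `latflow.core.hmc` runs it is exact**: links `ι → U(1)` with the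
product Haar probability measure, momenta `ι → ℝ` with Lebesgue measure and
`T = Σ_i p_i²/2` (refreshed as standard Gaussians), drift `V_i ← e^{i c p_i} V_i`, ANY measurable
force `g`, any trajectory length `n`, any measurable action `S`: the configuration kernel leaves
`e^{−S}·Haar^ι` invariant. -/
theorem u1_hmc_leapfrog_gaussian_exact {S : (ι → Circle) → ℝ} (hS : Measurable S) (c : ℝ)
    {g : (ι → Circle) → (ι → ℝ)} (hg : Measurable g) (n : ℕ) :
    Invariant
      (refreshUpdate
        (involMH
          (⇑((flip : Equiv.Perm ((ι → Circle) × (ι → ℝ))) *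
              leapfrog (mulDrift fun p : ι → ℝ => fun i => Circle.exp (c * p i)) g ^ n))
          (measurable_flip_leapfrog_pow (measurable_mulDrift (measurable_circleDrift c)) hg n)
          fun z : (ι → Circle) × (ι → ℝ) => S z.1 + ∑ i, z.2 i ^ 2 / 2)
        ((((volume : Measure (ι → ℝ)).withDensity
              fun p => ENNReal.ofReal (Real.exp (-(∑ i, p i ^ 2 / 2)))) Set.univ)⁻¹ •
          (volume : Measure (ι → ℝ)).withDensity
            fun p => ENNReal.ofReal (Real.exp (-(∑ i, p i ^ 2 / 2)))))
      ((Measure.pi fun _ : ι => haarProbability Circle).withDensity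
        fun U => ENNReal.ofReal (Real.exp (-S U))) := by
  haveI := isNegInvariant_volume_pi (Λ := ι)
  exact gauge_hmc_leapfrog_config_exact (μ := Measure.pi fun _ : ι => haarProbability Circle)
    (ν := (volume : Measure (ι → ℝ))) (e := fun p : ι → ℝ => fun i => Circle.exp (c * p i))
    (g := g) (S := S) (T := fun p : ι → ℝ => ∑ i, p i ^ 2 / 2)
    (fun p => circleDrift_neg c p) (measurable_circleDrift c)
    hg n hS measurable_piGaussianKinetic piGaussianWeight_univ_ne_zero_ne_top.1
    piGaussianWeight_univ_ne_zero_ne_top.2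

/-- **FT-HMC on the U(1) rung exactly as `latflow.fthmc` runs it is exact.**  Links `ι → U(1)`
with the product Haar probability measure; momenta `ι → ℝ` with Lebesgue measure and
`T = Σ_i p_i²/2`; a member `F : (ι → U(1)) ≃ᵐ (ι → U(1))` with positive measurable Jacobian `J`
for the product Haar measure (the engine's U(1) masked layers, any `C¹` degree-one coupling
layer, the NCP flows, and lists of such layers are certified in the sibling files); drift
`V_i ← e^{i c p_i} V_i`; ANY measurable force `g` (the autodiff force of
`S̃ = S ∘ F − log J` in the code); any `n`; any measurable action `S`.  Refresh → leapfrog^n →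
flip → Metropolis on `ΔH̃` → forget → report `U = F V`: this kernel leaves `e^{−S}·Haar^ι`
invariant.  (The step size, the trajectory length and the quality of `g` and of `F` move the
acceptance rate and the autocorrelations, never the sampled law.) -/
theorem u1_fthmc_leapfrog_gaussian_exact
    {F : (ι → Circle) ≃ᵐ (ι → Circle)} {J : (ι → Circle) → ℝ} (hJ : ∀ V, 0 < J V)
    (hJm : Measurable J)
    (hF : HasJacobian (Measure.pi fun _ : ι => haarProbability Circle) F
      fun V => ENNReal.ofReal (J V))
    {S : (ι → Circle) → ℝ} (hS : Measurable S) (c : ℝ) {g : (ι → Circle) → (ι → ℝ)}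
    (hg : Measurable g) (n : ℕ) :
    Invariant
      (conjKernel
        (refreshUpdate
          (involMH
            (⇑((flip : Equiv.Perm ((ι → Circle) × (ι → ℝ))) *
                leapfrog (mulDrift fun p : ι → ℝ => fun i => Circle.exp (c * p i)) g ^ n))
            (measurable_flip_leapfrog_pow (measurable_mulDrift (measurable_circleDrift c)) hg n)
            fun z : (ι → Circle) × (ι → ℝ) => (S (F z.1) - Real.log (J z.1)) + ∑ i, z.2 i ^ 2 / 2)
          ((((volume : Measure (ι → ℝ)).withDensity
                fun p => ENNReal.ofReal (Real.exp (-(∑ i, p i ^ 2 / 2)))) Set.univ)⁻¹ •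
            (volume : Measure (ι → ℝ)).withDensity
              fun p => ENNReal.ofReal (Real.exp (-(∑ i, p i ^ 2 / 2)))))
        F)
      ((Measure.pi fun _ : ι => haarProbability Circle).withDensity
        fun U => ENNReal.ofReal (Real.exp (-S U))) := by
  haveI := isNegInvariant_volume_pi (Λ := ι)
  exact gauge_fthmc_leapfrog_config_exact (μ := Measure.pi fun _ : ι => haarProbability Circle)
    (ν := (volume : Measure (ι → ℝ))) (F := F) (J := J)
    (e := fun p : ι → ℝ => fun i => Circle.exp (c * p i)) (g := g) (S := S)
    (T := fun p : ι → ℝ => ∑ i, p i ^ 2 / 2) hJ hJm hF (fun p => circleDrift_neg c p)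
    (measurable_circleDrift c) hg n hS measurable_piGaussianKinetic
    piGaussianWeight_univ_ne_zero_ne_top.1 piGaussianWeight_univ_ne_zero_ne_top.2

end U1

end Summit.Ventures.LatticeQCDFlow.Exactness
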